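import Summits.BirchSwinnertonDyer.BirchSwinnertonDyer.Theorems.ByReductionTypeAtTwoUniformKatoHalfSharp
import Summits.BirchSwinnertonDyer.BirchSwinnertonDyer.Theorems.ByReductionTypeAtTwoAdditiveKatoExceptionalPrimeDefs
import HarnessLib

/-!
# Crux `AdditiveRankZeroAtTwo` (K4 item 19098) and its three rank-`0` siblings: the Kato half at `2` on the WHOLE
# irreducible-`E[2]` locus — the twist exception of `missingUpperBoundAt_two_of_katoAtTwo_uniform` removed by ONE typed
# target (`AddKatoTwo.KatoSharpAtTwoAdditiveSplitTwist` = Kato's Conj. 12.10 at the exceptional prime of (12.5.1); seat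
# `bsd-2adic-addL2x` GEN 15, repair-census R-B76)

Cell `bsd-2adic`, rung K4, crux stmt-BirchSwinnertonDyer-19098 (split v2.2: children 22615–22619, glue 22620).
`--supports 19098 --as helper`. HONEST FRAMING (D-0036/D-0054): CONDITIONAL theorems; every research-grade input is
displayed; closes nothing at the `∀`-level; nothing booked; BSD is not proved by any of this. PARTITION: X5@2 × {E[2]
irreducible} × p = 2, the two additive split-twist sub-blocks (169 + 39 classes) folded in — types-the-object-of.

WHAT THIS FILE DOES. GEN 14's `SemistableKatoTwo.missingUpperBoundAt_two_of_katoAtTwo_uniform` (p659664) gives the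
Euler-system half `MissingUpperBoundAt W 2` for every non-CM analytic-rank-`0` `W` with irreducible `E[2]` under statement
(A) at `(W,2)`, WHATEVER the reduction at `2`, except — if `W` is additive — when `W^{(−1)}` or `W^{(−2)}` is split
multiplicative at `2` (binder `hnst`), where the readings give only `+ 2` / `+ 1` (T17/T18). GEN 15's R-B76 analysis
(docstring of `…AdditiveKatoExceptionalPrimeDefs.lean`, T19) locates that defect EXACTLY: it is the local term of Kato's
Thm. 12.5 (3) at the one exceptional height-one prime `𝔮'` of (12.5.1), where Kato's printed inequality is weaker by
length `1` than his printed Conj. 12.10; the sharp bound on those two classes IS 12.10 at `𝔮'` read through T1–T18, now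
the typed target `AddKatoTwo.KatoSharpAtTwoAdditiveSplitTwist` (conjecture-grade). This file is its consumer:

* §1 `padicValNat_shaOrder_le_of_katoSharp_at` / `missingUpperBoundAt_of_katoSharp_at` — the Miller-currency
  conversion AT ONE CURVE from the common CONCLUSION shape of all the lane's Kato-at-`2` statements
  (`∃ q, L(E,1)/Ω = q ∧ ord₂ #Ш(2) + v₂ Tam ≤ ord₂ q`), so that no further reading needs its own conversion lemma.
* §2 `missingUpperBoundAt_two_of_katoAtTwoSplitTwist` — the door on the two split-twist classes from the target.
* §3 **`missingUpperBoundAt_two_of_katoAtTwo_all`**: for EVERY non-CM globally minimal `W` of analytic rank `0` with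
  IRREDUCIBLE `E[2]`, statement (A) at `(W,2)` ⟹ `MissingUpperBoundAt W 2` — NO reduction hypothesis, NO twist
  hypothesis — from {readings `hKG`, `hKM` (p658927), `hNST2` (D-audit PASS)} + {target `hX`} + PRINT {GZK, modularity};
  `…_of_isAbelianGalois` ((A) from print when `ℚ(E[2])` is cyclic cubic); §4 the route-wide block forms
  `rankZeroAtTwo_upper_onIrreducible_all_of_conjA` (the Euler-system half of ALL FOUR rank-`0` cruxes on the irreducible
  locus ⟸ 3 readings + 1 target + PRINT + ONE research object: (A) on the `S₃`-image curves) and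
  `rankZeroAtTwo_bsdp_onIrreducible_all_of_conjA_of_lower` (BSD₂ there from that + the LOWER half over `ℚ`).

So on {non-CM, `r_an = 0`, irreducible `E[2]`} — all four reduction types at `2`, no exception — the rung-K4 leaf has the
one-sided residual shape {(A) on `S₃`-image, lower half} modulo {3 readings, 1 target}. Inputs BY NAME: `hKG`, `hKM`,
`hNST2` (Literature readings), `hX` (Summits target), `hGZK`, `hmod`, `hLim2`, `hFW`.
Memo: `run/shared/lean/pub/bsd-2adic/addL2x/VERDICT-19098-addL2x-GEN15.md`.

References: [Kato2004Asterisque] Thm. 12.5 (1)(3)(4), (12.5.1) (pp. 221–222), Conj. 12.10 (p. 224), 13.13 (pp. 233–234),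
14.14–14.16 (pp. 243–245); [SilvermanATAEC1994] V.5.3, Ex. 5.11; [Tate1975] §1; [CoatesSujatha2005] statement (A);
[Lim2017FineSelmer] §3 Thm. 3.5; [FerreroWashington1979]; [Miller2011LMS] Def. 1.1.
-/

set_option autoImplicit false
-- sibling precedent (`ByReductionTypeAtTwoUniformKatoHalfSharp.lean`): the directory name repeats the summit name
set_option linter.dupNamespace false

noncomputable section

open scoped Classical

namespace Summit.BirchSwinnertonDyer.BirchSwinnertonDyer.Theorems.SemistableKatoTwo

open WeierstrassCurve Literature.NumberTheory.EllipticCurves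
  Literature.NumberTheory.EllipticCurves.Rank1Residual
  Literature.NumberTheory.EllipticCurves.Rank1Residual.Typed
  Literature.NumberTheory.IwasawaTheory
  Summit.BirchSwinnertonDyer.BirchSwinnertonDyer.Theses.ByReductionTypeAtTwo
  Summit.BirchSwinnertonDyer.BirchSwinnertonDyer.Theorems.AddKatoTwo

/-! ## §1 The Miller-currency conversion at ONE curve, from the common conclusion shape -/

/-- **From the Kato-shape conclusion at a curve to the `Ш`-bound in Miller's currency.** For a globally minimal `W` of
analytic rank `0` (GZK: rank `0`, `Ш` finite; modularity: `L(E,1) ≠ 0`): if `L(E,1)/Ω(W) = q₀` with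
`ord₂ #Ш(E/ℚ)(2) + v₂(Tam W) ≤ ord₂ q₀` — the conclusion of every Kato-at-`2` statement of the lane — then
`#Ш_an(W) = q` for `q = q₀·#tors²/Tam` and `ord₂ #Ш(W) ≤ ord₂ q − 2·ord₂ #W(ℚ)_tors`. (The computation of
`AddKatoTwo.padicValNat_shaOrder_le_of_katoAtTwoNoSplitTwist_rankZero`, abstracted from the reading.)
[cite: Miller2011LMS, §1 and Def. 1.1] [cite: Kato2004Asterisque, Thm. 12.5 (1)(3) (pp. 221–222)] -/
theorem padicValNat_shaOrder_le_of_katoSharp_at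
    (hGZK : rank_eq_analyticRank_of_analyticRank_le_one) (hmod : hasEntireLFunction_rat)
    (W : WeierstrassCurve ℚ) [W.IsElliptic] [W.IsGloballyMinimal] (hr : W.analyticRank = 0)
    (hsharp : W.entireLFunction 1 ≠ 0 → Finite W.sha →
      ∃ q : ℚ, W.entireLFunction 1 / (W.realPeriodRat : ℂ) = (q : ℂ) ∧
        (padicValNat 2 (Nat.card (AddCommGroup.primaryComponent W.sha 2)) : ℤ) +
            padicValNat 2 W.tamagawaProduct ≤ padicValRat 2 q) :
    ∃ q : ℚ, shaAn W = (q : ℂ) ∧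
      (padicValNat 2 W.shaOrder : ℤ) ≤ padicValRat 2 q - 2 * padicValNat 2 W.torsionOrder := by
  have hL : W.entireLFunction 1 ≠ 0 := (W.analyticRank_eq_zero_iff_holds (hmod W)).mp hr
  obtain ⟨hmw, hfin⟩ := hGZK W (by rw [hr]; exact zero_le_one)
  haveI : Finite W.sha := hfin
  have hmw0 : W.mordellWeilRank = 0 := by rw [hmw, hr]
  obtain ⟨q₀, hq₀, hle⟩ := hsharp hL hfin
  have hΩpos : 0 < W.realPeriodRat := W.realPeriodRat_pos_holds
  have hΩ : (W.realPeriodRat : ℂ) ≠ 0 := by exact_mod_cast hΩpos.ne'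
  have hc0 : 0 < W.tamagawaProduct := W.tamagawaProduct_pos_holds
  have ht0 : 0 < W.torsionOrder := W.torsionOrder_pos_holds
  have hq₀0 : q₀ ≠ 0 := by
    rintro rfl
    rw [Rat.cast_zero, div_eq_zero_iff] at hq₀
    exact hq₀.elim hL hΩ
  refine ⟨q₀ * (W.torsionOrder : ℚ) ^ 2 / (W.tamagawaProduct : ℚ), ?_, ?_⟩
  · have hLq : W.entireLFunction 1 = (q₀ : ℂ) * (W.realPeriodRat : ℂ) := by
      rw [← hq₀, div_mul_cancel₀ _ hΩ]
    rw [shaAn_def, leadingLCoeff_eq_of_analyticRank_eq_zero W hr,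
      W.regulator_eq_one_of_rank_zero hmw0, hLq]
    push_cast
    field_simp
  · have ht : (W.torsionOrder : ℚ) ≠ 0 := by exact_mod_cast ht0.ne'
    have hcq : (W.tamagawaProduct : ℚ) ≠ 0 := by exact_mod_cast hc0.ne'
    have hsha : padicValNat 2 (Nat.card (AddCommGroup.primaryComponent W.sha 2)) =
        padicValNat 2 W.shaOrder := by
      unfold WeierstrassCurve.shaOrder
      exact padicValNat_card_addPrimaryComponent 2
    have hv : padicValRat 2 (q₀ * (W.torsionOrder : ℚ) ^ 2 / (W.tamagawaProduct : ℚ)) =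
        padicValRat 2 q₀ + 2 * (padicValNat 2 W.torsionOrder : ℤ) -
          (padicValNat 2 W.tamagawaProduct : ℤ) := by
      rw [padicValRat.div (mul_ne_zero hq₀0 (pow_ne_zero 2 ht)) hcq,
        padicValRat.mul hq₀0 (pow_ne_zero 2 ht), pow_two, padicValRat.mul ht ht,
        padicValRat.of_nat, padicValRat.of_nat]
      ring
    rw [hv, ← hsha]
    linarith

/-- **`MissingUpperBoundAt W 2` from the Kato-shape conclusion at a curve with IRREDUCIBLE `E[2]`** (torsion term `0`
by `padicValNat_torsionOrder_eq_zero_of_irreducible`). [cite: Miller2011LMS, Def. 1.1] -/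
theorem missingUpperBoundAt_of_katoSharp_at
    (hGZK : rank_eq_analyticRank_of_analyticRank_le_one) (hmod : hasEntireLFunction_rat)
    (W : WeierstrassCurve ℚ) [W.IsElliptic] [W.IsGloballyMinimal] (hr : W.analyticRank = 0)
    (hirr : W.HasIrreducibleModPGaloisRep 2)
    (hsharp : W.entireLFunction 1 ≠ 0 → Finite W.sha →
      ∃ q : ℚ, W.entireLFunction 1 / (W.realPeriodRat : ℂ) = (q : ℂ) ∧
        (padicValNat 2 (Nat.card (AddCommGroup.primaryComponent W.sha 2)) : ℤ) +
            padicValNat 2 W.tamagawaProduct ≤ padicValRat 2 q) :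
    MissingUpperBoundAt W 2 := by
  haveI : Fact (Nat.Prime 2) := ⟨Nat.prime_two⟩
  obtain ⟨q, hq, hle⟩ := padicValNat_shaOrder_le_of_katoSharp_at hGZK hmod W hr hsharp
  rw [padicValNat_torsionOrder_eq_zero_of_irreducible W 2 hirr] at hle
  simp only [Nat.cast_zero, mul_zero, sub_zero] at hle
  exact ⟨q, hq, hle⟩

/-! ## §2 The door on the two additive split-twist classes from the target -/

/-- **The Kato half at an ADDITIVE curve whose twist by `−1` or `−2` is split multiplicative at `2`**, `E[2]` irreducible,
from statement (A) at `(E,2)`, GRANTED the typed target `hX : AddKatoTwo.KatoSharpAtTwoAdditiveSplitTwist` (Kato's Conj.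
12.10 at the exceptional prime of (12.5.1), read through T1–T18; conjecture-grade), GZK and modularity.
[cite: Kato2004Asterisque, Conj. 12.10 (p. 224), Thm. 12.5 (3) and (12.5.1) (p. 222)] [cite: CoatesSujatha2005, statement (A)]
[cite: Miller2011LMS, Def. 1.1] -/
theorem missingUpperBoundAt_two_of_katoAtTwoSplitTwist (hX : KatoSharpAtTwoAdditiveSplitTwist)
    (hGZK : rank_eq_analyticRank_of_analyticRank_le_one) (hmod : hasEntireLFunction_rat)
    (W : WeierstrassCurve ℚ) [W.IsElliptic] [W.IsGloballyMinimal] (hcm : ¬ W.HasCM) (hr : W.analyticRank = 0)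
    (hadd : Addv W 2)
    (hst : ¬ (∀ d : ℚ, d = -1 ∨ d = -2 → ¬ (W.quadraticTwist d).HasSplitMultiplicativeReductionAtPrime 2))
    (hirr : W.HasIrreducibleModPGaloisRep 2)
    (hA : ∀ (κ : ZpExtension ℚ 2), κ.IsCyclotomic →
      ∃ (γ : Field.absoluteGaloisGroup ℚ) (D : W.FineSelmerDualData κ γ),
        Module.Finite ℤ_[2] (RestrictScalars ℤ_[2] (IwasawaAlgebra 2) D.X)) :
    MissingUpperBoundAt W 2 :=
  missingUpperBoundAt_of_katoSharp_at hGZK hmod W hr hirr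
    (fun hL hfin => hX W hcm hadd.1 hadd.2 hst hirr hA hL hfin)

/-! ## §3 THE KATO HALF AT `2` ON THE WHOLE IRREDUCIBLE LOCUS -/

/-- **THE KATO HALF AT `2` ON THE WHOLE IRREDUCIBLE-`E[2]` LOCUS.** For every non-CM globally minimal `W` of analytic rank
`0` with IRREDUCIBLE `E[2]`, statement (A) at `(W,2)` gives the Euler-system half `MissingUpperBoundAt W 2` — WHATEVER the
reduction of `W` at `2` and with NO twist hypothesis: good ordinary / supersingular by `hKG`, multiplicative by `hKM`
(reading p658927), additive with no split twist by `−1`/`−2` by `hNST2` (reading, D-audit PASS), additive with such a split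
twist by the target `hX` (Conj. 12.10 at the exceptional prime, R-B76). GZK and modularity for the currency.
[cite: Kato2004Asterisque, Thm. 12.5 (1)(3)(4) and (12.5.1) (pp. 221–222), Conj. 12.10 (p. 224), 13.13 (pp. 233–234), 14.14 (p. 243)]
[cite: SilvermanATAEC1994, Thm. V.5.3 and Exercise 5.11] [cite: Tate1975, §1] [cite: CoatesSujatha2005, statement (A)]
[cite: Miller2011LMS, Def. 1.1] -/
theorem missingUpperBoundAt_two_of_katoAtTwo_all
    (hKG : Kato2004.rankZero_padicValNat_sha_add_padicValNat_tamagawa_le_at_two_of_good_of_irreducible_of_fineSelmerDual_fg)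
    (hKM : Kato2004.rankZero_padicValNat_sha_add_padicValNat_tamagawa_le_at_two_of_multiplicative_of_irreducible_of_fineSelmerDual_fg)
    (hNST2 : Kato2004.rankZero_padicValNat_sha_add_padicValNat_tamagawa_le_at_two_of_noSplitTwistNegOneNegTwo_of_irreducible_of_fineSelmerDual_fg)
    (hX : KatoSharpAtTwoAdditiveSplitTwist)
    (hGZK : rank_eq_analyticRank_of_analyticRank_le_one) (hmod : hasEntireLFunction_rat)
    (W : WeierstrassCurve ℚ) [W.IsElliptic] [W.IsGloballyMinimal] (hcm : ¬ W.HasCM) (hr : W.analyticRank = 0)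
    (hirr : W.HasIrreducibleModPGaloisRep 2)
    (hA : ∀ (κ : ZpExtension ℚ 2), κ.IsCyclotomic →
      ∃ (γ : Field.absoluteGaloisGroup ℚ) (D : W.FineSelmerDualData κ γ),
        Module.Finite ℤ_[2] (RestrictScalars ℤ_[2] (IwasawaAlgebra 2) D.X)) :
    MissingUpperBoundAt W 2 := by
  by_cases hnst : Addv W 2 → ∀ d : ℚ, d = -1 ∨ d = -2 →
      ¬ (W.quadraticTwist d).HasSplitMultiplicativeReductionAtPrime 2
  · exact missingUpperBoundAt_two_of_katoAtTwo_uniform hKG hKM hNST2 hGZK hmod W hcm hr hirr hnst hA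
  · obtain ⟨hadd, hst⟩ := Classical.not_imp.mp hnst
    exact missingUpperBoundAt_two_of_katoAtTwoSplitTwist hX hGZK hmod W hcm hr hadd hst hirr hA

/-- **The same with (A) DISCHARGED from print when `ℚ(E[2])` is abelian** (cyclic cubic image: Lim 2017 Thm. 3.5 at `2` +
Ferrero–Washington, through `conjA_two_of_isAbelianGalois_divisionField_two`): PRINT + 3 readings + 1 target only.
[cite: Lim2017FineSelmer, §3 Thm. 3.5] [cite: FerreroWashington1979, Theorem] [cite: Kato2004Asterisque, Conj. 12.10 (p. 224)] -/
theorem missingUpperBoundAt_two_of_katoAtTwo_all_of_isAbelianGalois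
    (hKG : Kato2004.rankZero_padicValNat_sha_add_padicValNat_tamagawa_le_at_two_of_good_of_irreducible_of_fineSelmerDual_fg)
    (hKM : Kato2004.rankZero_padicValNat_sha_add_padicValNat_tamagawa_le_at_two_of_multiplicative_of_irreducible_of_fineSelmerDual_fg)
    (hNST2 : Kato2004.rankZero_padicValNat_sha_add_padicValNat_tamagawa_le_at_two_of_noSplitTwistNegOneNegTwo_of_irreducible_of_fineSelmerDual_fg)
    (hX : KatoSharpAtTwoAdditiveSplitTwist)
    (hGZK : rank_eq_analyticRank_of_analyticRank_le_one) (hmod : hasEntireLFunction_rat)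
    (hLim2 : Lim2017.thm35_at_two_fineSelmerDual_moduleFinite_of_classicalMuVanishes_of_le_divisionField_four)
    (hFW : ferreroWashington1979_classicalMuVanishes)
    (W : WeierstrassCurve ℚ) [W.IsElliptic] [W.IsGloballyMinimal] (hcm : ¬ W.HasCM) (hr : W.analyticRank = 0)
    (hirr : W.HasIrreducibleModPGaloisRep 2) (hab : IsAbelianGalois ℚ (W.divisionField 2)) :
    MissingUpperBoundAt W 2 := by
  haveI := hab
  exact missingUpperBoundAt_two_of_katoAtTwo_all hKG hKM hNST2 hX hGZK hmod W hcm hr hirr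
    (conjA_two_of_isAbelianGalois_divisionField_two hLim2 hFW W)

/-! ## §4 BLOCK forms for the route on the whole irreducible locus -/

/-- **The Euler-system half of ALL FOUR rank-`0` cruxes of the route on the whole irreducible-`E[2]` locus** — no reduction
and no twist exception — from {3 readings, 1 target} + PRINT {GZK, modularity, Lim@2, FW} + ONE research `∀`-object
`hAnaIrr` = statement (A) at `(W,2)` on the non-CM rank-`0` curves with irreducible `E[2]` and NON-abelian `ℚ(E[2])`
(Iwasawa's `μ₂ = 0` for the `S₃`-sextics `ℚ(W[2])`; the C1″-shaped object 22615, route-wide). Conditional; closes nothing.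
[cite: Kato2004Asterisque, Thm. 12.5 (3) and (12.5.1) (p. 222), Conj. 12.10 (p. 224), 14.14 (p. 243)]
[cite: CoatesSujatha2005, statement (A)] [cite: Lim2017FineSelmer, §3 Thm. 3.5] [cite: FerreroWashington1979, Theorem] -/
theorem rankZeroAtTwo_upper_onIrreducible_all_of_conjA
    (hKG : Kato2004.rankZero_padicValNat_sha_add_padicValNat_tamagawa_le_at_two_of_good_of_irreducible_of_fineSelmerDual_fg)
    (hKM : Kato2004.rankZero_padicValNat_sha_add_padicValNat_tamagawa_le_at_two_of_multiplicative_of_irreducible_of_fineSelmerDual_fg)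
    (hNST2 : Kato2004.rankZero_padicValNat_sha_add_padicValNat_tamagawa_le_at_two_of_noSplitTwistNegOneNegTwo_of_irreducible_of_fineSelmerDual_fg)
    (hX : KatoSharpAtTwoAdditiveSplitTwist)
    (hGZK : rank_eq_analyticRank_of_analyticRank_le_one) (hmod : hasEntireLFunction_rat)
    (hLim2 : Lim2017.thm35_at_two_fineSelmerDual_moduleFinite_of_classicalMuVanishes_of_le_divisionField_four)
    (hFW : ferreroWashington1979_classicalMuVanishes)
    (hAnaIrr : ∀ (W : WeierstrassCurve ℚ) [W.IsElliptic] [W.IsGloballyMinimal], ¬ W.HasCM → W.analyticRank = 0 →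
      W.HasIrreducibleModPGaloisRep 2 → ¬ IsAbelianGalois ℚ (W.divisionField 2) →
      ∀ (κ : ZpExtension ℚ 2), κ.IsCyclotomic →
        ∃ (γ : Field.absoluteGaloisGroup ℚ) (D : W.FineSelmerDualData κ γ),
          Module.Finite ℤ_[2] (RestrictScalars ℤ_[2] (IwasawaAlgebra 2) D.X)) :
    ∀ (W : WeierstrassCurve ℚ) [W.IsElliptic] [W.IsGloballyMinimal], ¬ W.HasCM → W.analyticRank = 0 →
      W.HasIrreducibleModPGaloisRep 2 → MissingUpperBoundAt W 2 := by
  intro W _ _ hcm hr hirr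
  by_cases hab : IsAbelianGalois ℚ (W.divisionField 2)
  · exact missingUpperBoundAt_two_of_katoAtTwo_all_of_isAbelianGalois hKG hKM hNST2 hX hGZK hmod hLim2 hFW W hcm hr
      hirr hab
  · exact missingUpperBoundAt_two_of_katoAtTwo_all hKG hKM hNST2 hX hGZK hmod W hcm hr hirr
      (hAnaIrr W hcm hr hirr hab)

/-- **BSD₂ on the whole irreducible locus from that Kato half and the LOWER half over `ℚ`** (`hLowIrr`, the
Eisenstein-side research object, route-wide): `missingPPartAt_of_lower_of_upper` + `bsdp_of_missingPPartAt`. So on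
{non-CM, `r_an = 0`, irreducible `E[2]`} — every reduction type at `2`, no exception — the rung-K4 leaf has the one-sided
residual shape {(A) on `S₃`-image, lower half} modulo {3 readings, 1 target}. Conditional; closes nothing.
[cite: Kato2004Asterisque, Conj. 12.10 (p. 224), Thm. 12.5 (3) (p. 222), 14.14 (p. 243)] [cite: CoatesSujatha2005, statement (A)]
[cite: Miller2011LMS, §1 and Def. 1.1] -/
theorem rankZeroAtTwo_bsdp_onIrreducible_all_of_conjA_of_lower
    (hKG : Kato2004.rankZero_padicValNat_sha_add_padicValNat_tamagawa_le_at_two_of_good_of_irreducible_of_fineSelmerDual_fg)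
    (hKM : Kato2004.rankZero_padicValNat_sha_add_padicValNat_tamagawa_le_at_two_of_multiplicative_of_irreducible_of_fineSelmerDual_fg)
    (hNST2 : Kato2004.rankZero_padicValNat_sha_add_padicValNat_tamagawa_le_at_two_of_noSplitTwistNegOneNegTwo_of_irreducible_of_fineSelmerDual_fg)
    (hX : KatoSharpAtTwoAdditiveSplitTwist)
    (hGZK : rank_eq_analyticRank_of_analyticRank_le_one) (hmod : hasEntireLFunction_rat)
    (hLim2 : Lim2017.thm35_at_two_fineSelmerDual_moduleFinite_of_classicalMuVanishes_of_le_divisionField_four)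
    (hFW : ferreroWashington1979_classicalMuVanishes)
    (hAnaIrr : ∀ (W : WeierstrassCurve ℚ) [W.IsElliptic] [W.IsGloballyMinimal], ¬ W.HasCM → W.analyticRank = 0 →
      W.HasIrreducibleModPGaloisRep 2 → ¬ IsAbelianGalois ℚ (W.divisionField 2) →
      ∀ (κ : ZpExtension ℚ 2), κ.IsCyclotomic →
        ∃ (γ : Field.absoluteGaloisGroup ℚ) (D : W.FineSelmerDualData κ γ),
          Module.Finite ℤ_[2] (RestrictScalars ℤ_[2] (IwasawaAlgebra 2) D.X))
    (hLowIrr : ∀ (W : WeierstrassCurve ℚ) [W.IsElliptic] [W.IsGloballyMinimal], ¬ W.HasCM → W.analyticRank = 0 →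
      W.HasIrreducibleModPGaloisRep 2 → MissingLowerBoundAt W 2) :
    ∀ (W : WeierstrassCurve ℚ) [W.IsElliptic] [W.IsGloballyMinimal], ¬ W.HasCM → W.analyticRank = 0 →
      W.HasIrreducibleModPGaloisRep 2 → BSDp W 2 := by
  intro W _ _ hcm hr hirr
  have hr1 : W.analyticRank ≤ 1 := by rw [hr]; exact zero_le_one
  exact bsdp_of_missingPPartAt W 2 hGZK hr1
    (missingPPartAt_of_lower_of_upper W 2 (hLowIrr W hcm hr hirr)
      (rankZeroAtTwo_upper_onIrreducible_all_of_conjA hKG hKM hNST2 hX hGZK hmod hLim2 hFW hAnaIrr W hcm hr hirr))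

end Summit.BirchSwinnertonDyer.BirchSwinnertonDyer.Theorems.SemistableKatoTwo

end
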